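import Summits.CriticalPhenomena.PercolationContinuityZ3.Theorems.PercNearOneGluingNoHeavyQuantLightSliceKnapsack
import Summits.CriticalPhenomena.PercolationContinuityZ3.Theorems.PercNearOneGluingNoHeavyQuantPricesTerms
import HarnessLib

/-!
# QUANT lane R8, T-DEC: the WIDE residue `LightSliceWide` — THE PRICE FORM of its light slice (eight terms, up to four mids, pure split)
# (census-2 g60)

builds on p205010 (kernel theorem, internal audit signed; external expert review pending)

Support file (`--supports stmt-CriticalPhenomena-4575`), QUANT lane seat prim-quant-census-2 (gen 60), rung R8 of `…/quant/LADDER.md`.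
Memo `run/shared/lean/prim/quant/prim-quant-census-2-g60/WIDE-G60.md`.  Theorems only, standard axioms, no sorries, no definitions.

* **`LawDec.lightSlice_decAtT_wide_of_prices`** — THE PRICE FORM OF THE WIDE CLASS: light pair `{p, m}` (gate `γ ∈ [0,1]`), atom
  positions `l < l′ < h′ ≤ h` with rates `0 ≤ c₂ < u < c₁`; the residue geometry of `LightSliceWide` (`p + h′ ≤ j`, `m + l′ ≤ j`,
  `m + l′ ≤ p + h′`, `j + 1 ≤ m + h′`, `T ≤ 2(m + l′)`), the cell `m + l` compatible with `p + h`.  If for all prices `β_H, β_M, β_G, β_1 ≥ 0`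
  of the mids `p+h′, m+l′, p+h, m+l` and all values `α_{P1}, α_{P2}, α_{M1} ≤ 1` of the lows `p+l, p+l′, m+l` satisfying `α ≤ usage·β` for
  the compatible low–mid pairs OF THE SAME PIECE (`P2 → PH, M2`; `P1, M1 → PG`; `P1 → M1`) the price inequality holds — with `if`s deciding
  whether `p + h` is a mid (`p + h ≤ j`) or a giant and whether `m + l` is a conv-low (`2(m+l) < T`) or a mid — then the light slice is
  `DECAtT x T j (M₁+M₂)`.  Via `lightSlice_eq_terms` and the all-mids criterion `decAtT_of_prices_terms` (`…QuantPricesTerms`).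
The class theorem `…QuantLightSliceWideHolds` discharges the price inequality with `WideCell.main_*` (`…QuantWideCellReal`).

[this work].  The gluing rows served [cite: KozmaNitzan2024, Conjecture 3 (p. 15)]; product measure [cite: Grimmett1999, §1.3 p. 10].
-/

noncomputable section

namespace Summit.CriticalPhenomena.PercolationContinuityZ3.Theorems

namespace Quant

open Finset

/-- the two-point law `{lo, hi; g}` (as in `…QuantLawDEC`) -/
local notation3 "TP[" lo ", " hi ", " g ", " h "]" =>
  (g : ℝ) * (if (h : ℕ) = (hi : ℕ) then (1 : ℝ) else 0) + (1 - (g : ℝ)) * (if (h : ℕ) = (lo : ℕ) then (1 : ℝ) else 0)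

namespace LawDec

set_option maxHeartbeats 4000000 in
/-- **THE PRICE FORM OF THE WIDE CLASS.**  See the module docstring. [this work] -/
theorem lightSlice_decAtT_wide_of_prices (x T T₂ γ : ℝ) (M₁ M₂ j p m l h l' h' : ℕ) (hx0 : 0 < x) (hx1 : x < 1)
    (hγ0 : 0 ≤ γ) (hγ1 : γ ≤ 1) (hc₂0 : 0 ≤ usage x T₂ j l' h') (hc₂u : usage x T₂ j l' h' < x / (1 - x)) (huc₁ : x / (1 - x) < usage x T₂ j l h)
    (hll' : l < l') (hl'h' : l' < h') (hh'h : h' ≤ h) (hmM : m ≤ M₁) (hhM : h ≤ M₂)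
    (hdeep₁ : p + h' ≤ j) (hdeep₂ : m + l' ≤ j) (htie : m + l' ≤ p + h') (htop : j + 1 ≤ m + h')
    (hmid : T ≤ 2 * ((m : ℝ) + l')) (hlow2 : 2 * ((p : ℝ) + l') < T)
    (hcompP : T < ((p : ℝ) + l') + ((p : ℝ) + h')) (hcompN : T < ((m : ℝ) + l) + ((p : ℝ) + h))
    (hdual : ∀ αP1 αP2 αM1 βH βM βG β1 : ℝ, 0 ≤ βH → 0 ≤ βM → 0 ≤ βG → 0 ≤ β1 → αP1 ≤ 1 → αP2 ≤ 1 →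
      (2 * ((m : ℝ) + l) < T → αM1 ≤ 1) →
      αP2 ≤ usage x T j (p + l') (p + h') * βH →
      (T < ((p : ℝ) + l') + ((m : ℝ) + l') → αP2 ≤ usage x T j (p + l') (m + l') * βM) →
      (p + h ≤ j → T < ((p : ℝ) + l) + ((p : ℝ) + h) → αP1 ≤ usage x T j (p + l) (p + h) * βG) →
      (p + h ≤ j → 2 * ((m : ℝ) + l) < T → αM1 ≤ usage x T j (m + l) (p + h) * βG) →
      (¬ (2 * ((m : ℝ) + l) < T) → T < ((p : ℝ) + l) + ((m : ℝ) + l) → αP1 ≤ usage x T j (p + l) (m + l) * β1) →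
      (1 - γ) * ((1 - x) / (usage x T₂ j l h - usage x T₂ j l' h') * (x / (1 - x) - usage x T₂ j l' h')) * αP1
        + (1 - γ) * ((1 - x) / (usage x T₂ j l h - usage x T₂ j l' h') * (usage x T₂ j l h - x / (1 - x))) * αP2
        + (if 2 * ((m : ℝ) + l) < T then
            γ * ((1 - x) / (usage x T₂ j l h - usage x T₂ j l' h') * (x / (1 - x) - usage x T₂ j l' h')) * αM1 else 0)
      ≤ βH * ((1 - γ) * ((1 - x) / (usage x T₂ j l h - usage x T₂ j l' h') * (usage x T₂ j l h - x / (1 - x))) * usage x T₂ j l' h')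
        + βM * (γ * ((1 - x) / (usage x T₂ j l h - usage x T₂ j l' h') * (usage x T₂ j l h - x / (1 - x))))
        + (if p + h ≤ j then
            βG * ((1 - γ) * ((1 - x) / (usage x T₂ j l h - usage x T₂ j l' h') * (x / (1 - x) - usage x T₂ j l' h')) * usage x T₂ j l h)
           else 0)
        + (if 2 * ((m : ℝ) + l) < T then 0 else
            β1 * (γ * ((1 - x) / (usage x T₂ j l h - usage x T₂ j l' h') * (x / (1 - x) - usage x T₂ j l' h'))))
        + ((1 - x) / x) *
          (γ * ((1 - x) / (usage x T₂ j l h - usage x T₂ j l' h') * (usage x T₂ j l h - x / (1 - x))) * usage x T₂ j l' h'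
            + γ * ((1 - x) / (usage x T₂ j l h - usage x T₂ j l' h') * (x / (1 - x) - usage x T₂ j l' h')) * usage x T₂ j l h
            + (if p + h ≤ j then 0 else
                (1 - γ) * ((1 - x) / (usage x T₂ j l h - usage x T₂ j l' h') * (x / (1 - x) - usage x T₂ j l' h')) * usage x T₂ j l h))) :
    DECAtT x T j (M₁ + M₂) (lconv M₁ M₂ (fun b => TP[p, m, γ, b]) (atomLaw x T₂ j l h l' h')) := by
  classical
  have h1x : 0 < 1 - x := by linarith
  have hK : 0 ≤ (1 - x) / (usage x T₂ j l h - usage x T₂ j l' h') := div_nonneg h1x.le (by linarith)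
  have hmE : 0 ≤ (1 - x) / (usage x T₂ j l h - usage x T₂ j l' h') * (x / (1 - x) - usage x T₂ j l' h') := mul_nonneg hK (by linarith)
  have hmC : 0 ≤ (1 - x) / (usage x T₂ j l h - usage x T₂ j l' h') * (usage x T₂ j l h - x / (1 - x)) := mul_nonneg hK (by linarith)
  have hc₁0 : 0 ≤ usage x T₂ j l h := by have := div_pos hx0 h1x; linarith
  have h1γ : 0 ≤ 1 - γ := by linarith
  -- the classification of the eight cells
  have htie' : ((m : ℝ) + l') ≤ (p : ℝ) + h' := by exact_mod_cast htie
  have hh'hr : (h' : ℝ) ≤ h := by exact_mod_cast hh'h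
  have hq0 : p + l ≤ j ∧ 2 * ((p : ℝ) + l) < T := ⟨by omega, by
    have : (l : ℝ) < l' := by exact_mod_cast hll'
    linarith⟩
  have hn1 : ¬ (p + h ≤ j ∧ 2 * ((p : ℝ) + h) < T) := fun hc => by linarith [hc.2]
  have hq2 : p + l' ≤ j ∧ 2 * ((p : ℝ) + l') < T := ⟨by omega, hlow2⟩
  have hn3 : ¬ (p + h' ≤ j ∧ 2 * ((p : ℝ) + h') < T) := fun hc => by linarith [hc.2]
  have hn5 : ¬ (m + h ≤ j ∧ 2 * ((m : ℝ) + h) < T) := fun hc => by omega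
  have hn6 : ¬ (m + l' ≤ j ∧ 2 * ((m : ℝ) + l') < T) := fun hc => by linarith [hc.2]
  have hn7 : ¬ (m + h' ≤ j ∧ 2 * ((m : ℝ) + h') < T) := fun hc => by omega
  have hm0 : ¬ (p + l ≤ j ∧ ¬ (2 * ((p : ℝ) + l) < T)) := fun hc => hc.2 hq0.2
  have hm2 : ¬ (p + l' ≤ j ∧ ¬ (2 * ((p : ℝ) + l') < T)) := fun hc => hc.2 hq2.2
  have hm3 : p + h' ≤ j ∧ ¬ (2 * ((p : ℝ) + h') < T) := ⟨hdeep₁, fun hc => hn3 ⟨hdeep₁, hc⟩⟩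
  have hm5 : ¬ (m + h ≤ j ∧ ¬ (2 * ((m : ℝ) + h) < T)) := fun hc => by omega
  have hm6 : m + l' ≤ j ∧ ¬ (2 * ((m : ℝ) + l') < T) := ⟨hdeep₂, fun hc => hn6 ⟨hdeep₂, hc⟩⟩
  have hm7 : ¬ (m + h' ≤ j ∧ ¬ (2 * ((m : ℝ) + h') < T)) := fun hc => by omega
  have hml_j : m + l ≤ j := by omega
  obtain ⟨hg0, hg2, hg3, hg4, hg5, hg6, hg7⟩ : ¬ (j + 1 ≤ p + l) ∧ ¬ (j + 1 ≤ p + l') ∧ ¬ (j + 1 ≤ p + h') ∧ ¬ (j + 1 ≤ m + l) ∧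
      (j + 1 ≤ m + h) ∧ ¬ (j + 1 ≤ m + l') ∧ (j + 1 ≤ m + h') := ⟨by omega, by omega, by omega, by omega, by omega, by omega, htop⟩
  rw [lightSlice_eq_terms x T₂ γ M₁ M₂ j p m l h l' h' (by omega) hhM (by omega) (by omega) (by omega) hmM]
  refine decAtT_of_prices_terms x T j (M₁ + M₂) _ _ hx0 hx1 ?_ ?_ ?_ ?_
  · intro i
    fin_cases i <;> first
      | exact mul_nonneg h1γ hmE
      | exact mul_nonneg h1γ (mul_nonneg hmE hc₁0)
      | exact mul_nonneg h1γ hmC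
      | exact mul_nonneg h1γ (mul_nonneg hmC hc₂0)
      | exact mul_nonneg hγ0 hmE
      | exact mul_nonneg hγ0 (mul_nonneg hmE hc₁0)
      | exact mul_nonneg hγ0 hmC
      | exact mul_nonneg hγ0 (mul_nonneg hmC hc₂0)
  · have hcc : usage x T₂ j l h - usage x T₂ j l' h' ≠ 0 := by linarith
    have h1x' : (1 : ℝ) - x ≠ 0 := h1x.ne'
    simp only [Fin.sum_univ_eight, Matrix.cons_val_zero, Matrix.cons_val_one, Matrix.cons_val]
    field_simp
    ring
  · intro i
    fin_cases i <;> simp <;> omega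
  intro α β hβ hα1 hαU
  -- the values and prices of the cell
  have hαP1 : α (p + l) ≤ 1 := by
    have h0 := hα1 0; simp only [Matrix.cons_val_zero, Nat.cast_add] at h0; exact h0 hq0.1 hq0.2
  have hαP2 : α (p + l') ≤ 1 := by
    have h0 := hα1 2; simp only [Matrix.cons_val, Nat.cast_add] at h0; exact h0 hq2.1 hq2.2
  have hαM1 : 2 * ((m : ℝ) + l) < T → α (m + l) ≤ 1 := fun hM1 => by
    have h0 := hα1 4; simp only [Matrix.cons_val, Nat.cast_add] at h0; exact h0 hml_j hM1
  have hαH : α (p + l') ≤ usage x T j (p + l') (p + h') * β (p + h') := by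
    have h0 := hαU 2 3; simp only [Matrix.cons_val, Nat.cast_add] at h0
    exact h0 hq2.1 hq2.2 hdeep₁ hm3.2 hcompP
  have hαM : T < ((p : ℝ) + l') + ((m : ℝ) + l') → α (p + l') ≤ usage x T j (p + l') (m + l') * β (m + l') := fun hcomp => by
    have h0 := hαU 2 6; simp only [Matrix.cons_val, Nat.cast_add] at h0
    exact h0 hq2.1 hq2.2 hdeep₂ hm6.2 hcomp
  have hαS : p + h ≤ j → T < ((p : ℝ) + l) + ((p : ℝ) + h) → α (p + l) ≤ usage x T j (p + l) (p + h) * β (p + h) :=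
    fun hPG hcomp => by
    have h0 := hαU 0 1; simp only [Matrix.cons_val_zero, Matrix.cons_val_one, Nat.cast_add] at h0
    exact h0 hq0.1 hq0.2 hPG (fun hc => hn1 ⟨hPG, hc⟩) hcomp
  have hαN : p + h ≤ j → 2 * ((m : ℝ) + l) < T → α (m + l) ≤ usage x T j (m + l) (p + h) * β (p + h) := fun hPG hM1 => by
    have h0 := hαU 4 1; simp only [Matrix.cons_val, Matrix.cons_val_one, Nat.cast_add] at h0
    exact h0 hml_j hM1 hPG (fun hc => hn1 ⟨hPG, hc⟩) hcompN
  have hα1' : ¬ (2 * ((m : ℝ) + l) < T) → T < ((p : ℝ) + l) + ((m : ℝ) + l) →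
      α (p + l) ≤ usage x T j (p + l) (m + l) * β (m + l) := fun hM1 hcomp => by
    have h0 := hαU 0 4; simp only [Matrix.cons_val_zero, Matrix.cons_val, Nat.cast_add] at h0
    exact h0 hq0.1 hq0.2 hml_j hM1 hcomp
  have key := hdual (α (p + l)) (α (p + l')) (α (m + l)) (β (p + h')) (β (m + l')) (β (p + h)) (β (m + l))
    (hβ _) (hβ _) (hβ _) (hβ _) hαP1 hαP2 hαM1 hαH hαM hαS hαN hα1'
  by_cases hPG : p + h ≤ j
  · have hm1 : p + h ≤ j ∧ ¬ (2 * ((p : ℝ) + h) < T) := ⟨hPG, fun hc => hn1 ⟨hPG, hc⟩⟩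
    have hg1 : ¬ (j + 1 ≤ p + h) := by omega
    rw [if_pos hPG, if_pos hPG] at key
    by_cases hM1 : 2 * ((m : ℝ) + l) < T
    · have hq4 : m + l ≤ j ∧ 2 * ((m : ℝ) + l) < T := ⟨hml_j, hM1⟩
      have hm4 : ¬ (m + l ≤ j ∧ ¬ (2 * ((m : ℝ) + l) < T)) := fun hc => hc.2 hM1
      rw [if_pos hM1, if_pos hM1] at key
      simp only [Fin.sum_univ_eight, Matrix.cons_val_zero, Matrix.cons_val_one, Matrix.cons_val, Nat.cast_add,
        if_pos hq0, if_neg hn1, if_pos hq2, if_neg hn3, if_pos hq4, if_neg hn5, if_neg hn6, if_neg hn7,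
        if_neg hm0, if_pos hm1, if_neg hm2, if_pos hm3, if_neg hm4, if_neg hm5, if_pos hm6, if_neg hm7,
        if_neg hg0, if_neg hg1, if_neg hg2, if_neg hg3, if_neg hg4, if_pos hg5, if_neg hg6, if_pos hg7, zero_add, add_zero]
      linarith [key]
    · have hn4 : ¬ (m + l ≤ j ∧ 2 * ((m : ℝ) + l) < T) := fun hc => hM1 hc.2
      have hm4 : m + l ≤ j ∧ ¬ (2 * ((m : ℝ) + l) < T) := ⟨hml_j, hM1⟩
      rw [if_neg hM1, if_neg hM1] at key
      simp only [Fin.sum_univ_eight, Matrix.cons_val_zero, Matrix.cons_val_one, Matrix.cons_val, Nat.cast_add,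
        if_pos hq0, if_neg hn1, if_pos hq2, if_neg hn3, if_neg hn4, if_neg hn5, if_neg hn6, if_neg hn7,
        if_neg hm0, if_pos hm1, if_neg hm2, if_pos hm3, if_pos hm4, if_neg hm5, if_pos hm6, if_neg hm7,
        if_neg hg0, if_neg hg1, if_neg hg2, if_neg hg3, if_neg hg4, if_pos hg5, if_neg hg6, if_pos hg7, zero_add, add_zero]
      linarith [key]
  · have hm1 : ¬ (p + h ≤ j ∧ ¬ (2 * ((p : ℝ) + h) < T)) := fun hc => hPG hc.1
    have hg1 : j + 1 ≤ p + h := by omega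
    rw [if_neg hPG, if_neg hPG] at key
    by_cases hM1 : 2 * ((m : ℝ) + l) < T
    · have hq4 : m + l ≤ j ∧ 2 * ((m : ℝ) + l) < T := ⟨hml_j, hM1⟩
      have hm4 : ¬ (m + l ≤ j ∧ ¬ (2 * ((m : ℝ) + l) < T)) := fun hc => hc.2 hM1
      rw [if_pos hM1, if_pos hM1] at key
      simp only [Fin.sum_univ_eight, Matrix.cons_val_zero, Matrix.cons_val_one, Matrix.cons_val, Nat.cast_add,
        if_pos hq0, if_neg hn1, if_pos hq2, if_neg hn3, if_pos hq4, if_neg hn5, if_neg hn6, if_neg hn7,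
        if_neg hm0, if_neg hm1, if_neg hm2, if_pos hm3, if_neg hm4, if_neg hm5, if_pos hm6, if_neg hm7,
        if_neg hg0, if_pos hg1, if_neg hg2, if_neg hg3, if_neg hg4, if_pos hg5, if_neg hg6, if_pos hg7, zero_add, add_zero]
      linarith [key]
    · have hn4 : ¬ (m + l ≤ j ∧ 2 * ((m : ℝ) + l) < T) := fun hc => hM1 hc.2
      have hm4 : m + l ≤ j ∧ ¬ (2 * ((m : ℝ) + l) < T) := ⟨hml_j, hM1⟩
      rw [if_neg hM1, if_neg hM1] at key
      simp only [Fin.sum_univ_eight, Matrix.cons_val_zero, Matrix.cons_val_one, Matrix.cons_val, Nat.cast_add,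
        if_pos hq0, if_neg hn1, if_pos hq2, if_neg hn3, if_neg hn4, if_neg hn5, if_neg hn6, if_neg hn7,
        if_neg hm0, if_neg hm1, if_neg hm2, if_pos hm3, if_pos hm4, if_neg hm5, if_pos hm6, if_neg hm7,
        if_neg hg0, if_pos hg1, if_neg hg2, if_neg hg3, if_neg hg4, if_pos hg5, if_neg hg6, if_pos hg7, zero_add, add_zero]
      linarith [key]

end LawDec

end Quant

end Summit.CriticalPhenomena.PercolationContinuityZ3.Theorems
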